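import Summits.PneNP.PneNP.Theorems.ConvexRankGatesConvexGateBlindExactLiftingTriangleJumpVacuous

/-!
# Triangle instance — uniqueness of the line representation of a NONDEGENERATE row

Support file for crux `ConvexGateBlind` (stmt-PneNP-10680), open stub `stub_exactLifting`; prover seat 0, session 35,
memo ANALYSIS14 §2 (= ANALYSIS12 §3.1 made precise). Companion of `…TriangleJumpVacuous`: there, a DEGENERATE row of
the triangle matrix `M_t[x,w] = monoCount x w` was shown to have two different representations as a non-negative
combination of the `3t²` line indicators. Here: if the row `x` is NONDEGENERATE — every block shows both colours,
equivalently `mu x ≠ 0` (`mu_ne_zero_iff`, `cp_ne_zero_iff`) — then the representation is UNIQUE: if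
`∑_L c_L 1_L = M_x` and `c_L ≥ 0` on the lines that are bichromatic under `x` (no sign condition on the monochromatic
ones), then `c_L = [L mono_x]` for every line (`lineRep_unique`).

Proof. `k := c − [mono]` satisfies `k₁₂(a,b) + k₁₃(a,d) + k₂₃(b,d) = 0` for all `(a,b,d)` and `k ≥ 0` on bichromatic
lines. In a `2×2×2` box `{a,a'}×{b,b'}×{d,d'}` with `a,b,d` of one colour and `a',b',d'` of the other, the six mixed
pairs are bichromatic, and the eight box equations force all twelve `k`-values on the box to vanish (`box_zero`, linear
arithmetic); by nondegeneracy every pair of vertices lies in such a box.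
-/

set_option linter.dupNamespace false -- `Summit.PneNP.PneNP.…`: summit = sub-problem (D-0017)

namespace Summit.PneNP.PneNP.Theorems.XorDoor.TriLine

open Finset

noncomputable section

variable {t : ℕ}

/-! ## Nondegenerate rows -/

/-- a block has a non-zero class-size product iff it shows both colours -/
lemma cp_ne_zero_iff (y : Fin t → Bool) : cp y ≠ 0 ↔ ∃ v v', y v ≠ y v' := by
  unfold cp
  rw [mul_ne_zero_iff, card_ne_zero, card_ne_zero]
  constructor
  · rintro ⟨⟨v, hv⟩, ⟨v', hv'⟩⟩
    rw [mem_cls] at hv hv'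
    exact ⟨v, v', by rw [hv, hv']; decide⟩
  · rintro ⟨v, v', h⟩
    have key : ∀ c : Bool, y v = c ∨ y v' = c := by
      intro c; revert h; cases y v <;> cases y v' <;> cases c <;> simp
    constructor
    · rcases key true with h1 | h1
      · exact ⟨v, mem_cls.2 h1⟩
      · exact ⟨v', mem_cls.2 h1⟩
    · rcases key false with h1 | h1
      · exact ⟨v, mem_cls.2 h1⟩
      · exact ⟨v', mem_cls.2 h1⟩

/-- `mu x ≠ 0` iff all three blocks have non-zero class-size products -/
lemma mu_ne_zero_iff (x : Col t) : mu x ≠ 0 ↔ cp x.1 ≠ 0 ∧ cp x.2.1 ≠ 0 ∧ cp x.2.2 ≠ 0 := by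
  unfold mu
  rw [mul_ne_zero_iff, mul_ne_zero_iff, Nat.cast_ne_zero, Nat.cast_ne_zero, Nat.cast_ne_zero, and_assoc]

/-- **Nondegenerate rows**: `mu x ≠ 0` iff every block shows both colours. -/
lemma mu_ne_zero_iff_two_coloured (x : Col t) : mu x ≠ 0 ↔
    (∃ a a', x.1 a ≠ x.1 a') ∧ (∃ b b', x.2.1 b ≠ x.2.1 b') ∧ (∃ d d', x.2.2 d ≠ x.2.2 d') := by
  rw [mu_ne_zero_iff, cp_ne_zero_iff, cp_ne_zero_iff, cp_ne_zero_iff]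

/-- in a two-coloured block, every colour is present and every colour is avoided -/
lemma exists_eq_and_ne {y : Fin t → Bool} {v₁ v₂ : Fin t} (h : y v₁ ≠ y v₂) (c : Bool) :
    (∃ v, y v = c) ∧ (∃ v, y v ≠ c) := by
  by_cases h1 : y v₁ = c
  · exact ⟨⟨v₁, h1⟩, ⟨v₂, fun h2 => h (h1.trans h2.symm)⟩⟩
  · refine ⟨⟨v₂, ?_⟩, ⟨v₁, h1⟩⟩
    revert h h1; cases y v₁ <;> cases y v₂ <;> cases c <;> simp

/-! ## The box lemma and uniqueness -/

/-- **The `2×2×2` box** (pure linear arithmetic): if `k₁₂(α,β) + k₁₃(α,γ) + k₂₃(β,γ) = 0` on the box `{a,a'}×{b,b'}×{d,d'}`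
and `k ≥ 0` on the six mixed pairs, then `k` vanishes on the pairs through `a` and `b`. -/
lemma box_zero {k₁₂ k₁₃ k₂₃ : Fin t → Fin t → ℝ} (hE : ∀ a b d, k₁₂ a b + k₁₃ a d + k₂₃ b d = 0)
    (a a' b b' d d' : Fin t) (s1 : 0 ≤ k₁₂ a b') (s2 : 0 ≤ k₁₂ a' b) (s3 : 0 ≤ k₁₃ a d') (s4 : 0 ≤ k₁₃ a' d)
    (s5 : 0 ≤ k₂₃ b d') (s6 : 0 ≤ k₂₃ b' d) :
    k₁₂ a b = 0 ∧ k₁₂ a b' = 0 ∧ k₁₃ a d = 0 ∧ k₁₃ a d' = 0 ∧ k₂₃ b d = 0 ∧ k₂₃ b d' = 0 := by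
  have e1 := hE a b d
  have e2 := hE a b d'
  have e3 := hE a b' d
  have e4 := hE a b' d'
  have e5 := hE a' b d
  have e6 := hE a' b d'
  have e7 := hE a' b' d
  have e8 := hE a' b' d'
  refine ⟨?_, ?_, ?_, ?_, ?_, ?_⟩ <;> linarith

/-- **Uniqueness of the line representation of a nondegenerate row.** If `mu x ≠ 0` and `∑_L c_L 1_L(w) = monoCount x w`
for all `w`, with `c_L ≥ 0` on the lines bichromatic under `x`, then `c_L = [L mono_x]` for every line `L`. -/
theorem lineRep_unique {x : Col t} (hx : mu x ≠ 0) {c : Line t → ℝ} (hc : ∀ L, ¬ lmono x L → 0 ≤ c L)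
    (hrep : ∀ w, ∑ L, c L * lind L w = (monoCount x w : ℝ)) : ∀ L, c L = mInd x L := by
  obtain ⟨⟨a₁, a₂, ha⟩, ⟨b₁, b₂, hb⟩, ⟨d₁, d₂, hd⟩⟩ := (mu_ne_zero_iff_two_coloured x).1 hx
  -- the difference to the line pattern
  obtain ⟨k, hk⟩ : ∃ k : Line t → ℝ, ∀ L, k L = c L - mInd x L := ⟨fun L => c L - mInd x L, fun _ => rfl⟩
  have hE : ∀ a b d, k (Sum.inl (a, b)) + k (Sum.inr (Sum.inl (a, d))) + k (Sum.inr (Sum.inr (b, d))) = 0 := by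
    intro a b d
    have h1 : ∑ L, k L * lind L (a, b, d) = 0 := by
      simp only [hk, sub_mul, sum_sub_distrib, hrep (a, b, d), sum_mInd_mul_lind x (a, b, d), sub_self]
    rwa [sum_mul_lind_eq_three] at h1
  have hs : ∀ L, ¬ lmono x L → 0 ≤ k L := by
    intro L hL; rw [hk]; unfold mInd; rw [if_neg hL, sub_zero]; exact hc L hL
  -- witnesses of each colour in each block
  have w1 : ∀ cc : Bool, (∃ v, x.1 v = cc) ∧ (∃ v, x.1 v ≠ cc) := fun cc => exists_eq_and_ne ha cc
  have w2 : ∀ cc : Bool, (∃ v, x.2.1 v = cc) ∧ (∃ v, x.2.1 v ≠ cc) := fun cc => exists_eq_and_ne hb cc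
  have w3 : ∀ cc : Bool, (∃ v, x.2.2 v = cc) ∧ (∃ v, x.2.2 v ≠ cc) := fun cc => exists_eq_and_ne hd cc
  -- the box lemma around vertices `a, b, d` of colour `cc` and `a', b', d'` of the other colour
  have box : ∀ (a a' b b' d d' : Fin t) (cc : Bool), x.1 a = cc → x.1 a' ≠ cc → x.2.1 b = cc → x.2.1 b' ≠ cc →
      x.2.2 d = cc → x.2.2 d' ≠ cc →
      k (Sum.inl (a, b)) = 0 ∧ k (Sum.inl (a, b')) = 0 ∧ k (Sum.inr (Sum.inl (a, d))) = 0 ∧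
        k (Sum.inr (Sum.inl (a, d'))) = 0 ∧ k (Sum.inr (Sum.inr (b, d))) = 0 ∧ k (Sum.inr (Sum.inr (b, d'))) = 0 := by
    intro a a' b b' d d' cc h1 h1' h2 h2' h3 h3'
    refine box_zero (k₁₂ := fun a b => k (Sum.inl (a, b))) (k₁₃ := fun a d => k (Sum.inr (Sum.inl (a, d))))
      (k₂₃ := fun b d => k (Sum.inr (Sum.inr (b, d)))) hE a a' b b' d d' ?_ ?_ ?_ ?_ ?_ ?_
    · exact hs (Sum.inl (a, b')) fun h => h2' ((show x.1 a = x.2.1 b' from h).symm.trans h1)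
    · exact hs (Sum.inl (a', b)) fun h => h1' ((show x.1 a' = x.2.1 b from h).trans h2)
    · exact hs (Sum.inr (Sum.inl (a, d'))) fun h => h3' ((show x.1 a = x.2.2 d' from h).symm.trans h1)
    · exact hs (Sum.inr (Sum.inl (a', d))) fun h => h1' ((show x.1 a' = x.2.2 d from h).trans h3)
    · exact hs (Sum.inr (Sum.inr (b, d'))) fun h => h3' ((show x.2.1 b = x.2.2 d' from h).symm.trans h2)
    · exact hs (Sum.inr (Sum.inr (b', d))) fun h => h2' ((show x.2.1 b' = x.2.2 d from h).trans h3)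
  suffices hzero : ∀ L, k L = 0 by
    intro L; have := hzero L; rw [hk] at this; linarith
  intro L
  rcases L with ⟨a, b⟩ | ⟨a, d⟩ | ⟨b, d⟩
  · obtain ⟨a', ha'⟩ := (w1 (x.1 a)).2
    obtain ⟨d₀, hd₀⟩ := (w3 (x.1 a)).1
    obtain ⟨d', hd'⟩ := (w3 (x.1 a)).2
    by_cases hbc : x.2.1 b = x.1 a
    · obtain ⟨b', hb'⟩ := (w2 (x.1 a)).2
      exact (box a a' b b' d₀ d' (x.1 a) rfl ha' hbc hb' hd₀ hd').1
    · obtain ⟨b₀, hb₀⟩ := (w2 (x.1 a)).1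
      exact (box a a' b₀ b d₀ d' (x.1 a) rfl ha' hb₀ hbc hd₀ hd').2.1
  · obtain ⟨a', ha'⟩ := (w1 (x.1 a)).2
    obtain ⟨b₀, hb₀⟩ := (w2 (x.1 a)).1
    obtain ⟨b', hb'⟩ := (w2 (x.1 a)).2
    by_cases hdc : x.2.2 d = x.1 a
    · obtain ⟨d', hd'⟩ := (w3 (x.1 a)).2
      exact (box a a' b₀ b' d d' (x.1 a) rfl ha' hb₀ hb' hdc hd').2.2.1
    · obtain ⟨d₀, hd₀⟩ := (w3 (x.1 a)).1
      exact (box a a' b₀ b' d₀ d (x.1 a) rfl ha' hb₀ hb' hd₀ hdc).2.2.2.1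
  · obtain ⟨a₀, ha₀⟩ := (w1 (x.2.1 b)).1
    obtain ⟨a', ha'⟩ := (w1 (x.2.1 b)).2
    obtain ⟨b', hb'⟩ := (w2 (x.2.1 b)).2
    by_cases hdc : x.2.2 d = x.2.1 b
    · obtain ⟨d', hd'⟩ := (w3 (x.2.1 b)).2
      exact (box a₀ a' b b' d d' (x.2.1 b) ha₀ ha' rfl hb' hdc hd').2.2.2.2.1
    · obtain ⟨d₀, hd₀⟩ := (w3 (x.2.1 b)).1
      exact (box a₀ a' b b' d₀ d (x.2.1 b) ha₀ ha' rfl hb' hd₀ hdc).2.2.2.2.2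

/-- **Uniqueness, factorisation form.** If the column functions of a line-indexed non-negative factorisation of `M_t` ARE
the line indicators (`v_L = 1_{σL}` up to the relabelling `σ`), then on every nondegenerate row the usage is the line
pattern: `u_L(x) = [σL mono_x]`. (On degenerate rows this fails: `…TriangleJumpVacuous`.) -/
theorem usage_eq_mInd_of_lines {u : Line t → Col t → ℝ} (hu : ∀ L x, 0 ≤ u L x) (σ : Equiv.Perm (Line t))
    (hf : ∀ x w, ∑ L, u L x * lind (σ L) w = (monoCount x w : ℝ)) {x : Col t} (hx : mu x ≠ 0) :
    ∀ L, u L x = mInd x (σ L) := by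
  intro L
  have h := lineRep_unique hx (c := fun L' => u (σ.symm L') x) (fun L' _ => hu _ _) (fun w => ?_) (σ L)
  · simpa using h
  · rw [← Equiv.sum_comp σ (fun L' => u (σ.symm L') x * lind L' w)]
    simp only [Equiv.symm_apply_apply]
    exact hf x w


/-- **Uniqueness of the line representation of a nondegenerate row** (registered sub-goal `triangle_lineRep_unique` of
stmt-PneNP-10680, verbatim signature, self-contained vocabulary): if every block of the colouring `x` shows both colours
and `∑_L c_L [w ∈ L]` equals the number of monochromatic edges of `w` for every triangle `w`, with `c ≥ 0`, then `c_L`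
is the line pattern `[L monochromatic under x]`. (For degenerate `x` this fails: `triangle_rigidity_hypothesis_false`.) -/
theorem triangle_lineRep_unique : ∀ (t : ℕ) (x : (Fin t → Bool) × (Fin t → Bool) × (Fin t → Bool)) (c : (Fin t × Fin
    t) ⊕ (Fin t × Fin t) ⊕ (Fin t × Fin t) → ℝ), (∃ a a', x.1 a ≠ x.1 a') → (∃ b b', x.2.1 b ≠ x.2.1 b') → (∃ d d',
    x.2.2 d ≠ x.2.2 d') → (∀ L, 0 ≤ c L) → (∀ w : Fin t × Fin t × Fin t, ∑ L, c L * Sum.elim (fun ab : Fin t × Fin t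
    => if w.1 = ab.1 ∧ w.2.1 = ab.2 then (1 : ℝ) else 0) (Sum.elim (fun ad : Fin t × Fin t => if w.1 = ad.1 ∧ w.2.2 =
    ad.2 then (1 : ℝ) else 0) (fun bd : Fin t × Fin t => if w.2.1 = bd.1 ∧ w.2.2 = bd.2 then (1 : ℝ) else 0)) L = ((if
    x.1 w.1 = x.2.1 w.2.1 then 1 else 0) + (if x.1 w.1 = x.2.2 w.2.2 then 1 else 0) + (if x.2.1 w.2.1 = x.2.2 w.2.2
    then 1 else 0) : ℝ)) → ∀ L, c L = Sum.elim (fun ab : Fin t × Fin t => if x.1 ab.1 = x.2.1 ab.2 then (1 : ℝ) else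
    0) (Sum.elim (fun ad : Fin t × Fin t => if x.1 ad.1 = x.2.2 ad.2 then (1 : ℝ) else 0) (fun bd : Fin t × Fin t =>
    if x.2.1 bd.1 = x.2.2 bd.2 then (1 : ℝ) else 0)) L := by
  intro t x c h1 h2 h3 hc hrep L
  have hx : mu x ≠ 0 := (mu_ne_zero_iff_two_coloured x).2 ⟨h1, h2, h3⟩
  rw [← mInd_eq_elim]
  refine lineRep_unique hx (fun L _ => hc L) (fun w => ?_) L
  rw [← sum_congr rfl fun L _ => by rw [lind_eq_elim L w], hrep w]
  simp only [monoCount]; push_cast; ring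

end

end Summit.PneNP.PneNP.Theorems.XorDoor.TriLine
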